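import Summits.KontsevichZagierPeriods.KontsevichZagierPeriods.Theses.LiftingCriteria
import Literature.NumberTheory.Transcendental.SemialgebraicLineDeriv
import Literature.NumberTheory.Transcendental.KZProduct
import Literature.NumberTheory.Transcendental.KZSemialgebraicComplex

/-!
# `DilationLiftAtOne` (stmt-KontsevichZagierPeriods-3571, route LiftingCriteria) — line
`registered`, stub `stub_singleGenerator` (S1, single-generator normal form)

For a Nash cube function `h` of dimension `N` (a function `ℚ`-semialgebraic and real analytic on
an open set `W ⊇ [0,1]^N`) write `v_h(ϖ) := ∫_{[0,1]^N} h(ϖ • z) dz` for its *dilation function*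
on `[0,1]`. This file proves the bookkeeping normal form used as the first step of the birth
skeleton of the crux `DilationLiftAtOne`: an integer combination `m₀ + Σᵢ mᵢ v_{gᵢ}` of dilation
functions of Nash cube functions `gᵢ` (of any dimensions `nᵢ`) is the dilation function `v_h`
of ONE Nash cube function `h`, of dimension `N = Σ nᵢ`.

The witness is built by iterated APPEND of coordinate blocks (induction over the finite index
set): the constant `m₀` is `v_h` for `h ≡ m₀` in dimension `0` (the cube `[0,1]^0` is a point of
mass `1`), and for two Nash cube functions `h₁` (dimension `N₁`, open set `W₁`) and `h₂`
(dimension `N₂`, open set `W₂`) the function `h(z) = h₁(z|_{N₁}) + h₂(z|^{N₂})` on the open set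
`W = {z | z|_{N₁} ∈ W₁} ∩ {z | z|^{N₂} ∈ W₂} ⊇ [0,1]^{N₁+N₂}` is again Nash (coordinate projections
are polynomial maps, composition and sums of semialgebraic functions — Bochnak–Coste–Roy 1998,
Prop. 2.2.6 — and of analytic functions) and satisfies `v_h = v_{h₁} + v_{h₂}` on `[0,1]`
(Fubini along `Fin.append : ℝ^{N₁} × ℝ^{N₂} ≃ ℝ^{N₁+N₂}`,
`Literature.NumberTheory.Transcendental.KZ.appendMeasurableEquiv`, and the unit mass of the
marginal cubes; the dilation `z ↦ ϖ • z` commutes with the block projections).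

## References

* M. Kontsevich, D. Zagier, *Periods* (2001), §1.1 ("periods form an algebra … Fubini"), §1.2.
* J. Bochnak, M. Coste, M.-F. Roy, *Real Algebraic Geometry* (1998), §2.2 (Prop. 2.2.6).
-/

noncomputable section

open scoped BigOperators
open MeasureTheory Set
open Literature.NumberTheory.Transcendental
open Literature.ModelTheory.ExponentialFields (IsSemialgebraic isSemialgebraic_univ)

namespace Summit.KontsevichZagierPeriods.LiftingCriteria.DilationLiftAtOne

/-! ### The closed unit cube: dilations, volume, integrability -/

/-- For `ϖ ∈ [0,1]` the dilation `z ↦ ϖ • z` maps the closed unit cube `[0,1]^N` into itself.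
[folklore] -/
theorem smul_mem_cube {N : ℕ} {ϖ : ℝ} (hϖ : ϖ ∈ Icc (0:ℝ) 1) {z : Fin N → ℝ}
    (hz : z ∈ Set.pi Set.univ (fun _ : Fin N => Icc (0:ℝ) 1)) :
    ϖ • z ∈ Set.pi Set.univ (fun _ : Fin N => Icc (0:ℝ) 1) := by
  rw [Set.mem_univ_pi] at hz ⊢
  intro i
  have hi := hz i
  simp only [Pi.smul_apply, smul_eq_mul, Set.mem_Icc] at hi ⊢
  exact ⟨mul_nonneg hϖ.1 hi.1, mul_le_one₀ hϖ.2 hi.1 hi.2⟩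

/-- The closed unit cube `[0,1]^N ⊆ ℝ^N` has Lebesgue measure `1`. [folklore] -/
theorem volume_cube (N : ℕ) :
    volume (Set.pi Set.univ (fun _ : Fin N => Icc (0:ℝ) 1)) = 1 := by
  rw [volume_pi_pi]
  simp only [Real.volume_Icc, sub_zero, ENNReal.ofReal_one, Finset.prod_const_one]

/-- Lebesgue measure restricted to the closed unit cube `[0,1]^N` is a finite measure.
[folklore] -/
theorem isFiniteMeasure_restrict_cube (N : ℕ) :
    IsFiniteMeasure ((volume : Measure (Fin N → ℝ)).restrict
      (Set.pi Set.univ (fun _ : Fin N => Icc (0:ℝ) 1))) :=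
  isFiniteMeasure_restrict.mpr (by rw [volume_cube]; exact ENNReal.one_ne_top)

/-- The closed unit cube `[0,1]^N` is compact. [folklore] -/
theorem isCompact_cube (N : ℕ) : IsCompact (Set.pi Set.univ (fun _ : Fin N => Icc (0:ℝ) 1)) :=
  isCompact_univ_pi fun _ => isCompact_Icc

/-- If `h` is real analytic on `W ⊇ [0,1]^N` and `ϖ ∈ [0,1]`, then the dilated function
`z ↦ h (ϖ • z)` is continuous on the cube `[0,1]^N`. [folklore] -/
theorem continuousOn_dilate {N : ℕ} {h : (Fin N → ℝ) → ℝ} {W : Set (Fin N → ℝ)}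
    (hWc : Set.pi Set.univ (fun _ : Fin N => Icc (0:ℝ) 1) ⊆ W) (ha : AnalyticOnNhd ℝ h W)
    {ϖ : ℝ} (hϖ : ϖ ∈ Icc (0:ℝ) 1) :
    ContinuousOn (fun z => h (ϖ • z)) (Set.pi Set.univ (fun _ : Fin N => Icc (0:ℝ) 1)) :=
  ha.continuousOn.comp (continuous_const_smul ϖ).continuousOn
    (fun _ hz => hWc (smul_mem_cube hϖ hz))

/-- If `h` is real analytic on `W ⊇ [0,1]^N` and `ϖ ∈ [0,1]`, then `z ↦ h (ϖ • z)` is integrable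
on the cube `[0,1]^N` (continuous on a compact set). [folklore] -/
theorem integrableOn_dilate {N : ℕ} {h : (Fin N → ℝ) → ℝ} {W : Set (Fin N → ℝ)}
    (hWc : Set.pi Set.univ (fun _ : Fin N => Icc (0:ℝ) 1) ⊆ W) (ha : AnalyticOnNhd ℝ h W)
    {ϖ : ℝ} (hϖ : ϖ ∈ Icc (0:ℝ) 1) :
    IntegrableOn (fun z => h (ϖ • z)) (Set.pi Set.univ (fun _ : Fin N => Icc (0:ℝ) 1)) volume :=
  (continuousOn_dilate hWc ha hϖ).integrableOn_compact (isCompact_cube N)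

/-! ### Appending two coordinate blocks -/

/-- The dilation commutes with the first block projection:
`(ϖ • append x y)|_{N₁} = ϖ • x`. [folklore] -/
theorem smul_append_castAdd {N₁ N₂ : ℕ} (ϖ : ℝ) (x : Fin N₁ → ℝ) (y : Fin N₂ → ℝ) :
    (fun i => (ϖ • Fin.append x y) (Fin.castAdd N₂ i)) = ϖ • x := by
  funext i
  simp

/-- The dilation commutes with the second block projection:
`(ϖ • append x y)|^{N₂} = ϖ • y`. [folklore] -/
theorem smul_append_natAdd {N₁ N₂ : ℕ} (ϖ : ℝ) (x : Fin N₁ → ℝ) (y : Fin N₂ → ℝ) :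
    (fun j => (ϖ • Fin.append x y) (Fin.natAdd N₁ j)) = ϖ • y := by
  funext j
  simp

/-- Under `Fin.append`, the unit cube of dimension `N₁ + N₂` is the product of the unit cubes of
dimensions `N₁` and `N₂`. [folklore] -/
theorem preimage_cube_append (N₁ N₂ : ℕ) :
    KZ.appendMeasurableEquiv N₁ N₂ ⁻¹' Set.pi Set.univ (fun _ : Fin (N₁ + N₂) => Icc (0:ℝ) 1) =
      Set.pi Set.univ (fun _ : Fin N₁ => Icc (0:ℝ) 1) ×ˢ
        Set.pi Set.univ (fun _ : Fin N₂ => Icc (0:ℝ) 1) := by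
  ext p
  simp only [Set.mem_preimage, KZ.appendMeasurableEquiv_apply, Set.mem_prod, Set.mem_univ_pi]
  constructor
  · intro hp
    exact ⟨fun i => by simpa using hp (Fin.castAdd N₂ i),
      fun j => by simpa using hp (Fin.natAdd N₁ j)⟩
  · rintro ⟨hx, hy⟩ i
    refine Fin.addCases (fun i => ?_) (fun j => ?_) i
    · simpa using hx i
    · simpa using hy j

section Blocks

variable {N₁ N₂ : ℕ} {h₁ : (Fin N₁ → ℝ) → ℝ} {W₁ : Set (Fin N₁ → ℝ)}
  {h₂ : (Fin N₂ → ℝ) → ℝ} {W₂ : Set (Fin N₂ → ℝ)}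

/-- The two-block domain `{z | z|_{N₁} ∈ W₁ ∧ z|^{N₂} ∈ W₂}` is open when `W₁`, `W₂` are
(preimages under the continuous coordinate projections). [folklore] -/
theorem isOpen_blocks (ho₁ : IsOpen W₁) (ho₂ : IsOpen W₂) :
    IsOpen {z : Fin (N₁ + N₂) → ℝ | (fun i => z (Fin.castAdd N₂ i)) ∈ W₁ ∧
      (fun j => z (Fin.natAdd N₁ j)) ∈ W₂} := by
  have c₁ : Continuous fun (z : Fin (N₁ + N₂) → ℝ) (i : Fin N₁) => z (Fin.castAdd N₂ i) :=
    continuous_pi fun i => continuous_apply _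
  have c₂ : Continuous fun (z : Fin (N₁ + N₂) → ℝ) (j : Fin N₂) => z (Fin.natAdd N₁ j) :=
    continuous_pi fun j => continuous_apply _
  exact (ho₁.preimage c₁).inter (ho₂.preimage c₂)

/-- The unit cube of dimension `N₁ + N₂` lies in the two-block domain as soon as the unit cubes
of dimensions `N₁`, `N₂` lie in `W₁`, `W₂`. [folklore] -/
theorem cube_subset_blocks (hc₁ : Set.pi Set.univ (fun _ : Fin N₁ => Icc (0:ℝ) 1) ⊆ W₁)
    (hc₂ : Set.pi Set.univ (fun _ : Fin N₂ => Icc (0:ℝ) 1) ⊆ W₂) :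
    Set.pi Set.univ (fun _ : Fin (N₁ + N₂) => Icc (0:ℝ) 1) ⊆
      {z : Fin (N₁ + N₂) → ℝ | (fun i => z (Fin.castAdd N₂ i)) ∈ W₁ ∧
        (fun j => z (Fin.natAdd N₁ j)) ∈ W₂} := by
  intro z hz
  rw [Set.mem_univ_pi] at hz
  exact ⟨hc₁ (Set.mem_univ_pi.mpr fun i => hz (Fin.castAdd N₂ i)),
    hc₂ (Set.mem_univ_pi.mpr fun j => hz (Fin.natAdd N₁ j))⟩

/-- **Semialgebraicity of the appended function.** If `h₁`, `h₂` are `ℚ`-semialgebraic on `W₁`,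
`W₂`, then `z ↦ h₁ (z|_{N₁}) + h₂ (z|^{N₂})` is `ℚ`-semialgebraic on the two-block domain: the
domain is semialgebraic (coordinate preimages of the semialgebraic sets `W₁`, `W₂` — projections
of graphs, Tarski–Seidenberg), the block projections are polynomial maps, and composites and sums
of real semialgebraic functions are semialgebraic. [Bochnak–Coste–Roy 1998, §2.1, Prop. 2.2.6] -/
theorem isSemialgebraicFunOn_blocks (hs₁ : IsSemialgebraicFunOn ℚ W₁ h₁)
    (hs₂ : IsSemialgebraicFunOn ℚ W₂ h₂) :
    IsSemialgebraicFunOn ℚ {z : Fin (N₁ + N₂) → ℝ | (fun i => z (Fin.castAdd N₂ i)) ∈ W₁ ∧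
        (fun j => z (Fin.natAdd N₁ j)) ∈ W₂}
      (fun z => h₁ (fun i => z (Fin.castAdd N₂ i)) + h₂ (fun j => z (Fin.natAdd N₁ j))) := by
  have hσ₁ : IsSemialgebraic ℚ W₁ := IsSemialgebraicFunOn.isSemialgebraic_holds hs₁
  have hσ₂ : IsSemialgebraic ℚ W₂ := IsSemialgebraicFunOn.isSemialgebraic_holds hs₂
  have hW : IsSemialgebraic ℚ {z : Fin (N₁ + N₂) → ℝ | (fun i => z (Fin.castAdd N₂ i)) ∈ W₁ ∧
      (fun j => z (Fin.natAdd N₁ j)) ∈ W₂} :=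
    (hσ₁.preimage_comp (Fin.castAdd N₂)).inter (hσ₂.preimage_comp (Fin.natAdd N₁))
  have hp₁ : IsSemialgebraicMapOn ℚ {z : Fin (N₁ + N₂) → ℝ | (fun i => z (Fin.castAdd N₂ i)) ∈ W₁ ∧
      (fun j => z (Fin.natAdd N₁ j)) ∈ W₂} (fun z (i : Fin N₁) => z (Fin.castAdd N₂ i)) :=
    (isSemialgebraicMapOn_aeval hW
      (fun i : Fin N₁ => (MvPolynomial.X (Fin.castAdd N₂ i) : MvPolynomial (Fin (N₁ + N₂)) ℚ))).congr
      (fun z _ => funext fun i => by simp)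
  have hp₂ : IsSemialgebraicMapOn ℚ {z : Fin (N₁ + N₂) → ℝ | (fun i => z (Fin.castAdd N₂ i)) ∈ W₁ ∧
      (fun j => z (Fin.natAdd N₁ j)) ∈ W₂} (fun z (j : Fin N₂) => z (Fin.natAdd N₁ j)) :=
    (isSemialgebraicMapOn_aeval hW
      (fun j : Fin N₂ => (MvPolynomial.X (Fin.natAdd N₁ j) : MvPolynomial (Fin (N₁ + N₂)) ℚ))).congr
      (fun z _ => funext fun j => by simp)
  have hf₁ : IsSemialgebraicFunOn ℚ {z : Fin (N₁ + N₂) → ℝ | (fun i => z (Fin.castAdd N₂ i)) ∈ W₁ ∧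
      (fun j => z (Fin.natAdd N₁ j)) ∈ W₂} (fun z => h₁ (fun i => z (Fin.castAdd N₂ i))) :=
    IsSemialgebraicFunOn.comp_isSemialgebraicMapOn_holds hs₁ hp₁ (fun _ hz => hz.1)
  have hf₂ : IsSemialgebraicFunOn ℚ {z : Fin (N₁ + N₂) → ℝ | (fun i => z (Fin.castAdd N₂ i)) ∈ W₁ ∧
      (fun j => z (Fin.natAdd N₁ j)) ∈ W₂} (fun z => h₂ (fun j => z (Fin.natAdd N₁ j))) :=
    IsSemialgebraicFunOn.comp_isSemialgebraicMapOn_holds hs₂ hp₂ (fun _ hz => hz.2)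
  exact hf₁.fun_add hf₂

/-- **Analyticity of the appended function.** If `h₁`, `h₂` are real analytic on `W₁`, `W₂`,
then `z ↦ h₁ (z|_{N₁}) + h₂ (z|^{N₂})` is real analytic on the two-block domain (the block
projections are continuous linear maps). [folklore] -/
theorem analyticOnNhd_blocks (ha₁ : AnalyticOnNhd ℝ h₁ W₁) (ha₂ : AnalyticOnNhd ℝ h₂ W₂) :
    AnalyticOnNhd ℝ
      (fun z => h₁ (fun i => z (Fin.castAdd N₂ i)) + h₂ (fun j => z (Fin.natAdd N₁ j)))
      {z : Fin (N₁ + N₂) → ℝ | (fun i => z (Fin.castAdd N₂ i)) ∈ W₁ ∧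
        (fun j => z (Fin.natAdd N₁ j)) ∈ W₂} := by
  have hq₁ : AnalyticOnNhd ℝ (fun (z : Fin (N₁ + N₂) → ℝ) (i : Fin N₁) => z (Fin.castAdd N₂ i))
      {z : Fin (N₁ + N₂) → ℝ | (fun i => z (Fin.castAdd N₂ i)) ∈ W₁ ∧
        (fun j => z (Fin.natAdd N₁ j)) ∈ W₂} :=
    AnalyticOnNhd.pi fun i =>
      (ContinuousLinearMap.proj (R := ℝ) (φ := fun _ : Fin (N₁ + N₂) => ℝ)
        (Fin.castAdd N₂ i)).analyticOnNhd _
  have hq₂ : AnalyticOnNhd ℝ (fun (z : Fin (N₁ + N₂) → ℝ) (j : Fin N₂) => z (Fin.natAdd N₁ j))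
      {z : Fin (N₁ + N₂) → ℝ | (fun i => z (Fin.castAdd N₂ i)) ∈ W₁ ∧
        (fun j => z (Fin.natAdd N₁ j)) ∈ W₂} :=
    AnalyticOnNhd.pi fun j =>
      (ContinuousLinearMap.proj (R := ℝ) (φ := fun _ : Fin (N₁ + N₂) => ℝ)
        (Fin.natAdd N₁ j)).analyticOnNhd _
  have hf₁ : AnalyticOnNhd ℝ (fun (z : Fin (N₁ + N₂) → ℝ) => h₁ (fun i => z (Fin.castAdd N₂ i)))
      {z : Fin (N₁ + N₂) → ℝ | (fun i => z (Fin.castAdd N₂ i)) ∈ W₁ ∧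
        (fun j => z (Fin.natAdd N₁ j)) ∈ W₂} :=
    ha₁.comp hq₁ (fun _ hz => hz.1)
  have hf₂ : AnalyticOnNhd ℝ (fun (z : Fin (N₁ + N₂) → ℝ) => h₂ (fun j => z (Fin.natAdd N₁ j)))
      {z : Fin (N₁ + N₂) → ℝ | (fun i => z (Fin.castAdd N₂ i)) ∈ W₁ ∧
        (fun j => z (Fin.natAdd N₁ j)) ∈ W₂} :=
    ha₂.comp hq₂ (fun _ hz => hz.2)
  exact hf₁.add hf₂

/-- **Block Fubini on the unit cube.** For `h₁`, `h₂` real analytic near the unit cubes and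
`ϖ ∈ [0,1]`,
`∫_{[0,1]^{N₁+N₂}} (h₁((ϖz)|_{N₁}) + h₂((ϖz)|^{N₂})) dz = ∫_{[0,1]^{N₁}} h₁(ϖx) dx + ∫_{[0,1]^{N₂}} h₂(ϖy) dy`:
transport along the measure-preserving `Fin.append` (`KZ.appendMeasurableEquiv`), under which the
big cube is the product of the small cubes, then integrate each summand over the other factor,
whose cube has mass `1`. [Kontsevich–Zagier 2001, §1.1 ("Fubini formula")] -/
theorem setIntegral_cube_blocks
    (hc₁ : Set.pi Set.univ (fun _ : Fin N₁ => Icc (0:ℝ) 1) ⊆ W₁) (ha₁ : AnalyticOnNhd ℝ h₁ W₁)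
    (hc₂ : Set.pi Set.univ (fun _ : Fin N₂ => Icc (0:ℝ) 1) ⊆ W₂) (ha₂ : AnalyticOnNhd ℝ h₂ W₂)
    {ϖ : ℝ} (hϖ : ϖ ∈ Icc (0:ℝ) 1) :
    ∫ z in Set.pi Set.univ (fun _ : Fin (N₁ + N₂) => Icc (0:ℝ) 1),
        (h₁ (fun i => (ϖ • z) (Fin.castAdd N₂ i)) + h₂ (fun j => (ϖ • z) (Fin.natAdd N₁ j))) =
      (∫ x in Set.pi Set.univ (fun _ : Fin N₁ => Icc (0:ℝ) 1), h₁ (ϖ • x)) +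
        ∫ y in Set.pi Set.univ (fun _ : Fin N₂ => Icc (0:ℝ) 1), h₂ (ϖ • y) := by
  rw [← (KZ.volume_preserving_appendMeasurableEquiv (n := N₁) (m := N₂)).setIntegral_preimage_emb
    (KZ.appendMeasurableEquiv N₁ N₂).measurableEmbedding, preimage_cube_append]
  simp only [KZ.appendMeasurableEquiv_apply, smul_append_castAdd, smul_append_natAdd]
  rw [Measure.volume_eq_prod, ← Measure.prod_restrict]
  haveI := isFiniteMeasure_restrict_cube N₁
  haveI := isFiniteMeasure_restrict_cube N₂
  have hi₁ := integrableOn_dilate hc₁ ha₁ hϖ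
  have hi₂ := integrableOn_dilate hc₂ ha₂ hϖ
  rw [IntegrableOn] at hi₁ hi₂
  rw [integral_add (hi₁.comp_fst _) (hi₂.comp_snd _),
    integral_fun_fst (fun x : Fin N₁ → ℝ => h₁ (ϖ • x)),
    integral_fun_snd (fun y : Fin N₂ → ℝ => h₂ (ϖ • y)),
    measureReal_restrict_apply_univ, measureReal_restrict_apply_univ, measureReal_def,
    measureReal_def, volume_cube, volume_cube, ENNReal.toReal_one, one_smul, one_smul]

/-- **Appending two Nash cube functions.** The two-block data
`(N₁ + N₂, z ↦ h₁ (z|_{N₁}) + h₂ (z|^{N₂}), {z | z|_{N₁} ∈ W₁ ∧ z|^{N₂} ∈ W₂})` is again a Nash cube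
datum (open set containing the closed unit cube, `ℚ`-semialgebraic and real-analytic function).
[Bochnak–Coste–Roy 1998, Prop. 2.2.6] -/
theorem nash_blocks (ho₁ : IsOpen W₁) (hc₁ : Set.pi Set.univ (fun _ : Fin N₁ => Icc (0:ℝ) 1) ⊆ W₁)
    (hs₁ : IsSemialgebraicFunOn ℚ W₁ h₁) (ha₁ : AnalyticOnNhd ℝ h₁ W₁)
    (ho₂ : IsOpen W₂) (hc₂ : Set.pi Set.univ (fun _ : Fin N₂ => Icc (0:ℝ) 1) ⊆ W₂)
    (hs₂ : IsSemialgebraicFunOn ℚ W₂ h₂) (ha₂ : AnalyticOnNhd ℝ h₂ W₂) :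
    IsOpen {z : Fin (N₁ + N₂) → ℝ | (fun i => z (Fin.castAdd N₂ i)) ∈ W₁ ∧
        (fun j => z (Fin.natAdd N₁ j)) ∈ W₂} ∧
      Set.pi Set.univ (fun _ : Fin (N₁ + N₂) => Icc (0:ℝ) 1) ⊆
        {z : Fin (N₁ + N₂) → ℝ | (fun i => z (Fin.castAdd N₂ i)) ∈ W₁ ∧
          (fun j => z (Fin.natAdd N₁ j)) ∈ W₂} ∧
      IsSemialgebraicFunOn ℚ {z : Fin (N₁ + N₂) → ℝ | (fun i => z (Fin.castAdd N₂ i)) ∈ W₁ ∧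
          (fun j => z (Fin.natAdd N₁ j)) ∈ W₂}
        (fun z => h₁ (fun i => z (Fin.castAdd N₂ i)) + h₂ (fun j => z (Fin.natAdd N₁ j))) ∧
      AnalyticOnNhd ℝ
        (fun z => h₁ (fun i => z (Fin.castAdd N₂ i)) + h₂ (fun j => z (Fin.natAdd N₁ j)))
        {z : Fin (N₁ + N₂) → ℝ | (fun i => z (Fin.castAdd N₂ i)) ∈ W₁ ∧
          (fun j => z (Fin.natAdd N₁ j)) ∈ W₂} :=
  ⟨isOpen_blocks ho₁ ho₂, cube_subset_blocks hc₁ hc₂, isSemialgebraicFunOn_blocks hs₁ hs₂,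
    analyticOnNhd_blocks ha₁ ha₂⟩

end Blocks

/-! ### The stub -/

/-- **Stub S1 — single-generator normal form** (registered stub `stub_singleGenerator` of the
birth skeleton of crux stmt-KontsevichZagierPeriods-3571 `DilationLiftAtOne`). An integer
combination `m₀ + Σᵢ mᵢ v_{gᵢ}` of dilation functions `v_g(ϖ) = ∫_{[0,1]^n} g(ϖ • z) dz` of Nash
cube functions `gᵢ` (any dimensions `nᵢ`) is, on `[0,1]`, the dilation function `v_h` of ONE Nash
cube function `h` of some dimension `N`. Proof: induction over the finite index set; the empty
combination is the constant `m₀ = v_{m₀}` in dimension `0` (the cube `[0,1]^0` is a point of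
mass `1`), and adjoining one index `a` appends the block `mₐ · gₐ` to the function obtained so
far (`nash_blocks`, `setIntegral_cube_blocks`). Transcendence-free bookkeeping of the dilation
module. [Kontsevich–Zagier 2001, §1.1–§1.2] -/
theorem stub_singleGenerator :
    ∀ (S : ℕ) (n : Fin S → ℕ) (g : (i : Fin S) → (Fin (n i) → ℝ) → ℝ) (U : (i : Fin S) → Set (Fin (n i) → ℝ)), (∀ i, IsOpen (U i) ∧ Set.pi Set.univ (fun _ : Fin (n i) => Set.Icc (0:ℝ) 1) ⊆ (U i) ∧ Literature.NumberTheory.Transcendental.IsSemialgebraicFunOn ℚ (U i) (g i) ∧ AnalyticOnNhd ℝ (g i) (U i)) → ∀ (m : Fin S → ℤ) (m₀ : ℤ), ∃ (N : ℕ) (h : (Fin N → ℝ) → ℝ) (W : Set (Fin N → ℝ)), (IsOpen W ∧ Set.pi Set.univ (fun _ : Fin N => Set.Icc (0:ℝ) 1) ⊆ W ∧ Literature.NumberTheory.Transcendental.IsSemialgebraicFunOn ℚ W h ∧ AnalyticOnNhd ℝ h W) ∧ ∀ ϖ ∈ Set.Icc (0:ℝ) 1, (m₀ : ℝ) + ∑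 i, (m i : ℝ) * (∫ z in Set.pi Set.univ (fun _ : Fin (n i) => Set.Icc (0:ℝ) 1), g i (ϖ • z)) = ∫ z in Set.pi Set.univ (fun _ : Fin N => Set.Icc (0:ℝ) 1), h (ϖ • z) := by
  intro S n g U hg m m₀
  classical
  -- generalise the sum over `Finset.univ` to an arbitrary finite index set and induct on it
  suffices key : ∀ s : Finset (Fin S), ∃ (N : ℕ) (h : (Fin N → ℝ) → ℝ) (W : Set (Fin N → ℝ)),
      (IsOpen W ∧ Set.pi Set.univ (fun _ : Fin N => Set.Icc (0:ℝ) 1) ⊆ W ∧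
        IsSemialgebraicFunOn ℚ W h ∧ AnalyticOnNhd ℝ h W) ∧
      ∀ ϖ ∈ Set.Icc (0:ℝ) 1, (m₀ : ℝ) + ∑ i ∈ s, (m i : ℝ) *
          (∫ z in Set.pi Set.univ (fun _ : Fin (n i) => Set.Icc (0:ℝ) 1), g i (ϖ • z)) =
        ∫ z in Set.pi Set.univ (fun _ : Fin N => Set.Icc (0:ℝ) 1), h (ϖ • z) by
    exact key Finset.univ
  intro s
  induction s using Finset.induction_on with
  | empty =>
    -- the constant `m₀` in dimension `0`
    refine ⟨0, fun _ => (m₀ : ℝ), Set.univ, ⟨isOpen_univ, Set.subset_univ _,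
      isSemialgebraicFunOn_const_intCast isSemialgebraic_univ m₀, analyticOnNhd_const⟩, ?_⟩
    intro ϖ _
    rw [Finset.sum_empty, add_zero, setIntegral_const, measureReal_def, volume_cube,
      ENNReal.toReal_one, one_smul]
  | insert a s ha ih =>
    -- append the block `m a • g a` (dimension `n a`) to the function representing the sum over `s`
    obtain ⟨N', h', W', ⟨hW'o, hW'c, hW's, hW'a⟩, hv⟩ := ih
    obtain ⟨hUo, hUc, hUs, hUa⟩ := hg a
    have hUσ : IsSemialgebraic ℚ (U a) := IsSemialgebraicFunOn.isSemialgebraic_holds hUs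
    have hs₂ : IsSemialgebraicFunOn ℚ (U a) (fun y => (m a : ℝ) * g a y) :=
      (isSemialgebraicFunOn_const_intCast hUσ (m a)).fun_mul hUs
    have ha₂ : AnalyticOnNhd ℝ (fun y => (m a : ℝ) * g a y) (U a) :=
      analyticOnNhd_const.mul hUa
    refine ⟨N' + n a, _, _, nash_blocks hW'o hW'c hW's hW'a hUo hUc hs₂ ha₂, ?_⟩
    intro ϖ hϖ
    rw [setIntegral_cube_blocks hW'c hW'a hUc ha₂ hϖ, ← hv ϖ hϖ, Finset.sum_insert ha,
      integral_const_mul]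
    ring

end Summit.KontsevichZagierPeriods.LiftingCriteria.DilationLiftAtOne

end
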